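import Summits.Ventures.LatticeQCDFlow.Exactness.IMHVariationalBound
import HarnessLib

/-!
# The variational principle of the exact flow sampler, test-function side: `2⟨g, v⟩_w − 𝓔(v) ≤ Σ_{k≥0} C(k)`

HONEST FRAMING: exact (Metropolis-corrected) sampling algorithms for lattice gauge theory;
figures of merit are autocorrelation/cost numbers at stated couplings and volumes; no
continuum-physics claim.

Venture `LatticeQCDFlow` (cell pub-lqcd), topic `Exactness`; FANOUT row 4 (`s0-u1-b`, S0-B
implementation B: an INDEPENDENT code path for the same gauge-equivariant flow + independence
Metropolis sampler; acceptance clause "`τ_int(Q)` A vs B within `1σ_comb`").  NEW WORK of the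
cell over the tree's general-measure-space flow-sampler toolbox (`imhOp`, `imhFlow`,
`dirichlet_eq_half_sq`, `neumannSum_facts`, `dirichlet_neumannSum_le`, `autocov_nonneg`,
`integral_iterate_mul_iterate`, `sq_integral_mul_mul_le`); nothing is cited as a fact.  Printed
counterpart NAMED ONLY: the variational (`H₋₁`) formula for the asymptotic variance of a
reversible chain, `σ²_∞(g) + ‖g‖² = 2 sup_v [2⟨g, v⟩ − 𝓔(v)]` (Kipnis–Varadhan 1986, Comm.
Math. Phys. 104); here an ELEMENTARY one-sided form for the flow sampler without spectral theory
or resolvents, the input of the model-comparison law of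
`Exactness/IMHTauIntModelComparison.lean`.  The tree already had the OTHER side (the partial
Neumann sums as test functions, `IMHVariationalBound.dirichlet_neumannSum_le`).

## Setting

`(X, μ)` s-finite; target weight `w > 0` measurable integrable; model density `q > 0` measurable
with `∫ q = 1`; `K = imhOp μ w q`; `𝓔(v) = ∫ v² w − ∫ v (Kv) w` the Dirichlet form of a bounded
measurable `v`; `g` bounded measurable, `C(k) = ∫ g (Kᵏ g) w` its stationary autocovariances.

## What is proved

* `imhOp_const_mul` (`K (c·v) = c·Kv`), **`dirichlet_nonneg`** (`𝓔 ≥ 0`),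
  `dirichlet_const_mul` (`𝓔(c·v) = c² 𝓔(v)`);
* **`two_inner_sub_dirichlet_le_dirichlet`** — completing the square:
  `2(⟨u, v⟩_w − ⟨Ku, v⟩_w) − 𝓔(v) ≤ 𝓔(u)` for bounded measurable `u`, `v` (it is `𝓔(u − v) ≥ 0`
  expanded by linearity and self-adjointness of `K`);
* **`two_inner_sub_dirichlet_le_greenKubo`** — if `Σ_k C(k+1)` is summable then for EVERY
  bounded measurable `v`: `2 ∫ g v w − 𝓔(v) ≤ ∫ g² w + Σ_{k≥0} C(k+1)`.
  Proof: at `u = v_N = Σ_{k≤N} Kᵏ g` one has `(1 − K) v_N = g − K^{N+1} g` and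
  `𝓔(v_N) ≤ Σ_{k≤N} C(k)`, leaving the error `2⟨K^{N+1} g, v⟩_w ≤ 2 (C(2N+2) ∫ v² w)^{1/2} → 0`.

NOT CLAIMED: the equality (supremum attained), which needs the Poisson equation; anything for
HMC / local Metropolis; unbounded observables; any number.
-/

namespace Summit.Ventures.LatticeQCDFlow.Exactness

open Real MeasureTheory Filter Set Topology
open Summit.Ventures.LatticeQCDFlow.Scoring

variable {X : Type*} [MeasurableSpace X] {μ : Measure X} {w q : X → ℝ}

variable [SFinite μ]

/-! ## §1 Quadratic-form algebra of the Dirichlet form (one model) -/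

omit [SFinite μ] in
/-- `K` is homogeneous on observables: `K (c·v) = c·(K v)`. -/
theorem imhOp_const_mul (c : ℝ) (v : X → ℝ) (t : X) :
    imhOp μ w q (fun s => c * v s) t = c * imhOp μ w q v t := by
  unfold imhOp
  rw [← integral_const_mul]
  refine integral_congr_ae (Eventually.of_forall fun t' => ?_)
  show (imhAcceptQ w q t t' * (c * v t') + (1 - imhAcceptQ w q t t') * (c * v t)) * q t'
    = c * ((imhAcceptQ w q t t' * v t' + (1 - imhAcceptQ w q t t') * v t) * q t')
  ring

/-- **The Dirichlet form is nonnegative**: `0 ≤ ∫ v² w − ∫ v (Kv) w` for bounded measurable `v`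
(it is `½ ∫∫ s (v − v')²` with `s ≥ 0`). -/
theorem dirichlet_nonneg (hw0 : ∀ t, 0 < w t) (hwm : Measurable w) (hwi : Integrable w μ)
    (hq0 : ∀ t, 0 < q t) (hqm : Measurable q) (hqi : Integrable q μ) (hq1 : ∫ z, q z ∂μ = 1)
    {v : X → ℝ} (hvm : Measurable v) {B : ℝ} (hvb : ∀ t, |v t| ≤ B) :
    0 ≤ (∫ t, v t ^ 2 * w t ∂μ) - ∫ t, v t * imhOp μ w q v t * w t ∂μ := by
  rw [dirichlet_eq_half_sq hw0 hwm hwi hq0 hqm hqi hq1 hvm hvb]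
  refine mul_nonneg (by norm_num) (integral_nonneg fun p => ?_)
  exact mul_nonneg (imhFlow_nonneg_le hw0 hq0 p.1 p.2).1 (sq_nonneg _)

omit [SFinite μ] in
/-- **Homogeneity of the Dirichlet form**: `𝓔(c·v) = c² 𝓔(v)`. -/
theorem dirichlet_const_mul (c : ℝ) (v : X → ℝ) :
    (∫ t, (c * v t) ^ 2 * w t ∂μ) - ∫ t, (c * v t) * imhOp μ w q (fun s => c * v s) t * w t ∂μ
      = c ^ 2 * ((∫ t, v t ^ 2 * w t ∂μ) - ∫ t, v t * imhOp μ w q v t * w t ∂μ) := by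
  simp_rw [imhOp_const_mul]
  rw [mul_sub, ← integral_const_mul, ← integral_const_mul]
  congr 1
  · exact integral_congr_ae (Eventually.of_forall fun t => by ring)
  · exact integral_congr_ae (Eventually.of_forall fun t => by ring)

/-- **Completing the square**: for bounded measurable `u`, `v`,
`2(⟨u, v⟩_w − ⟨Ku, v⟩_w) − 𝓔(v) ≤ 𝓔(u)` — i.e. `𝓔(u − v) ≥ 0` expanded with the linearity and the
self-adjointness of `K`. -/
theorem two_inner_sub_dirichlet_le_dirichlet (hw0 : ∀ t, 0 < w t) (hwm : Measurable w)
    (hwi : Integrable w μ) (hq0 : ∀ t, 0 < q t) (hqm : Measurable q) (hqi : Integrable q μ)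
    (hq1 : ∫ z, q z ∂μ = 1) {u v : X → ℝ} (hum : Measurable u) (hvm : Measurable v) {Bu Bv : ℝ}
    (hub : ∀ t, |u t| ≤ Bu) (hvb : ∀ t, |v t| ≤ Bv) :
    2 * ((∫ t, u t * v t * w t ∂μ) - ∫ t, imhOp μ w q u t * v t * w t ∂μ)
        - ((∫ t, v t ^ 2 * w t ∂μ) - ∫ t, v t * imhOp μ w q v t * w t ∂μ)
      ≤ (∫ t, u t ^ 2 * w t ∂μ) - ∫ t, u t * imhOp μ w q u t * w t ∂μ := by
  -- the difference `d = u − v`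
  have hdm : Measurable fun s => u s - v s := hum.sub hvm
  have hdb : ∀ s, |u s - v s| ≤ Bu + Bv := fun s =>
    (abs_sub _ _).trans (add_le_add (hub s) (hvb s))
  have hD := dirichlet_nonneg hw0 hwm hwi hq0 hqm hqi hq1 hdm hdb
  -- linearity `K(u − v) = Ku − Kv`
  have hK : ∀ t, imhOp μ w q (fun s => u s - v s) t = imhOp μ w q u t - imhOp μ w q v t := by
    intro t
    have e : (fun s => u s - v s) = fun s => u s + (-1) * v s := by
      funext s; ring
    rw [e, imhOp_add_mul hw0 hwm hq0 hqm hqi hum hvm hub hvb (-1) t]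
    ring
  -- self-adjointness `∫ (Ku) v w = ∫ u (Kv) w`
  have hsymm := integral_imhOp_mul_mul_comm hw0 hwm hwi hq0 hqm hqi hum hvm hub hvb
  -- the bounded measurable images
  have hKum : Measurable (imhOp μ w q u) := measurable_imhOp hwm hqm hum
  have hKvm : Measurable (imhOp μ w q v) := measurable_imhOp hwm hqm hvm
  have hKub : ∀ t, |imhOp μ w q u t| ≤ Bu := imhOp_abs_le hw0 hq0 hqi hq1 hub
  have hKvb : ∀ t, |imhOp μ w q v t| ≤ Bv := imhOp_abs_le hw0 hq0 hqi hq1 hvb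
  -- integrable pieces
  have iuu : Integrable (fun t => u t * u t * w t) μ := integrable_mul_mul_weight hw0 hwm hwi hum hum hub hub
  have iuv : Integrable (fun t => u t * v t * w t) μ := integrable_mul_mul_weight hw0 hwm hwi hum hvm hub hvb
  have ivv : Integrable (fun t => v t * v t * w t) μ := integrable_mul_mul_weight hw0 hwm hwi hvm hvm hvb hvb
  have iuKu : Integrable (fun t => u t * imhOp μ w q u t * w t) μ :=
    integrable_mul_mul_weight hw0 hwm hwi hum hKum hub hKub
  have ivKv : Integrable (fun t => v t * imhOp μ w q v t * w t) μ :=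
    integrable_mul_mul_weight hw0 hwm hwi hvm hKvm hvb hKvb
  have iKuv : Integrable (fun t => imhOp μ w q u t * v t * w t) μ :=
    integrable_mul_mul_weight hw0 hwm hwi hKum hvm hKub hvb
  have iuKv : Integrable (fun t => u t * imhOp μ w q v t * w t) μ :=
    integrable_mul_mul_weight hw0 hwm hwi hum hKvm hub hKvb
  -- expand `∫ (u − v)² w`
  have e1 : ∫ t, (u t - v t) ^ 2 * w t ∂μ
      = (∫ t, u t ^ 2 * w t ∂μ) - 2 * (∫ t, u t * v t * w t ∂μ) + ∫ t, v t ^ 2 * w t ∂μ := by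
    have e : ∀ t, (u t - v t) ^ 2 * w t
        = (u t * u t * w t - 2 * (u t * v t * w t)) + v t * v t * w t := fun t => by ring
    simp_rw [e]
    have i1 : Integrable (fun t => u t * u t * w t - 2 * (u t * v t * w t)) μ :=
      iuu.sub (iuv.const_mul 2)
    rw [integral_add i1 ivv, integral_sub iuu (iuv.const_mul 2), integral_const_mul]
    have hu2 : ∫ t, u t * u t * w t ∂μ = ∫ t, u t ^ 2 * w t ∂μ :=
      integral_congr_ae (Eventually.of_forall fun t => by ring)
    have hv2 : ∫ t, v t * v t * w t ∂μ = ∫ t, v t ^ 2 * w t ∂μ :=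
      integral_congr_ae (Eventually.of_forall fun t => by ring)
    rw [hu2, hv2]
  -- expand `∫ (u − v) K(u − v) w`
  have e2 : ∫ t, (u t - v t) * imhOp μ w q (fun s => u s - v s) t * w t ∂μ
      = (∫ t, u t * imhOp μ w q u t * w t ∂μ) - 2 * (∫ t, imhOp μ w q u t * v t * w t ∂μ)
        + ∫ t, v t * imhOp μ w q v t * w t ∂μ := by
    have e : ∀ t, (u t - v t) * imhOp μ w q (fun s => u s - v s) t * w t
        = (u t * imhOp μ w q u t * w t - (imhOp μ w q u t * v t * w t + u t * imhOp μ w q v t * w t))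
          + v t * imhOp μ w q v t * w t := fun t => by rw [hK t]; ring
    simp_rw [e]
    have i3 : Integrable (fun t => imhOp μ w q u t * v t * w t + u t * imhOp μ w q v t * w t) μ :=
      iKuv.add iuKv
    have i2 : Integrable (fun t => u t * imhOp μ w q u t * w t
        - (imhOp μ w q u t * v t * w t + u t * imhOp μ w q v t * w t)) μ := iuKu.sub i3
    rw [integral_add i2 ivKv, integral_sub iuKu i3, integral_add iKuv iuKv, ← hsymm]
    ring
  rw [e1, e2] at hD
  linarith

/-! ## §2 The variational principle, test-function side -/

/-- **`2⟨g, v⟩_w − 𝓔(v) ≤ Σ_{k≥0} C(k)` FOR EVERY TEST FUNCTION.**  `w, q > 0` measurable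
integrable, `∫ q = 1`, `K = imhOp μ w q`; `g` bounded measurable whose autocovariance series
`C(k) = ∫ g (Kᵏ g) w` is summable; `v` bounded measurable.  Then
`2 ∫ g v w − (∫ v² w − ∫ v (Kv) w) ≤ ∫ g² w + Σ_{k≥0} C(k+1)`.
(Completing the square against the partial Neumann sums `v_N = Σ_{k≤N} Kᵏ g`, whose Dirichlet
form is below the partial Green–Kubo sum, leaves the error `2⟨K^{N+1} g, v⟩_w`, which is at most
`2 (C(2N+2) ∫ v² w)^{1/2} → 0`.) -/
theorem two_inner_sub_dirichlet_le_greenKubo (hw0 : ∀ t, 0 < w t) (hwm : Measurable w)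
    (hwi : Integrable w μ) (hq0 : ∀ t, 0 < q t) (hqm : Measurable q) (hqi : Integrable q μ)
    (hq1 : ∫ z, q z ∂μ = 1) {g : X → ℝ} (hgm : Measurable g) {B : ℝ} (hgb : ∀ t, |g t| ≤ B)
    (hs : Summable fun k => ∫ t, g t * ((imhOp μ w q)^[k + 1] g) t * w t ∂μ)
    {v : X → ℝ} (hvm : Measurable v) {Bv : ℝ} (hvb : ∀ t, |v t| ≤ Bv) :
    2 * (∫ t, g t * v t * w t ∂μ) - ((∫ t, v t ^ 2 * w t ∂μ) - ∫ t, v t * imhOp μ w q v t * w t ∂μ)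
      ≤ (∫ t, g t ^ 2 * w t ∂μ) + ∑' k, ∫ t, g t * ((imhOp μ w q)^[k + 1] g) t * w t ∂μ := by
  set C : ℕ → ℝ := fun k => ∫ t, g t * ((imhOp μ w q)^[k] g) t * w t ∂μ with hCdef
  set V : ℝ := ∫ t, v t ^ 2 * w t ∂μ with hVdef
  set S : ℝ := (∫ t, g t ^ 2 * w t ∂μ) + ∑' k, C (k + 1) with hSdef
  have hC0 : C 0 = ∫ t, g t ^ 2 * w t ∂μ := by
    simp only [hCdef, Function.iterate_zero, id_eq]
    exact integral_congr_ae (Eventually.of_forall fun t => by ring)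
  have hCnn : ∀ k, 0 ≤ C k := fun k => autocov_nonneg hw0 hwm hwi hq0 hqm hqi hq1 hgm hgb k
  have two := integral_iterate_mul_iterate hw0 hwm hwi hq0 hqm hqi hq1 hgm hgb
  -- Step 1: the bound with the Neumann-sum error term, for every `N`
  have hstep : ∀ N : ℕ,
      2 * (∫ t, g t * v t * w t ∂μ) - ((∫ t, v t ^ 2 * w t ∂μ) - ∫ t, v t * imhOp μ w q v t * w t ∂μ)
        ≤ S + 2 * Real.sqrt (C (2 * N + 1 + 1) * V) := by
    intro N
    obtain ⟨hm, hb, hK⟩ := neumannSum_facts hw0 hwm hq0 hqm hqi hq1 hgm hgb N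
    obtain ⟨hNm, hNb⟩ := imhOp_iterate_bdd (μ := μ) hw0 hwm hq0 hqm hqi hq1 (N + 1) hgm hgb
    have hsq := two_inner_sub_dirichlet_le_dirichlet hw0 hwm hwi hq0 hqm hqi hq1 hm hvm hb hvb
    have hdir := dirichlet_neumannSum_le hw0 hwm hwi hq0 hqm hqi hq1 hgm hgb N
    -- partial Green–Kubo sum ≤ S
    have hpart : ∑ k ∈ Finset.range (N + 1), C k ≤ S := by
      have h := hs.sum_le_tsum (Finset.range N) fun k _ => hCnn (k + 1)
      change ∑ k ∈ Finset.range N, C (k + 1) ≤ ∑' k, C (k + 1) at h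
      rw [Finset.sum_range_succ', hC0, hSdef]
      linarith
    -- `⟨(1 − K) v_N, v⟩ = ⟨g, v⟩ − ⟨K^{N+1} g, v⟩` (telescoping)
    have i0 : Integrable (fun t => g t * v t * w t) μ :=
      integrable_mul_mul_weight hw0 hwm hwi hgm hvm hgb hvb
    have iN1 : Integrable (fun t => ((imhOp μ w q)^[N + 1] g) t * v t * w t) μ :=
      integrable_mul_mul_weight hw0 hwm hwi hNm hvm hNb hvb
    have htel : (∫ t, (∑ k ∈ Finset.range (N + 1), ((imhOp μ w q)^[k] g) t) * v t * w t ∂μ)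
        - ∫ t, imhOp μ w q (fun y => ∑ k ∈ Finset.range (N + 1), ((imhOp μ w q)^[k] g) y) t
            * v t * w t ∂μ
        = (∫ t, g t * v t * w t ∂μ) - ∫ t, ((imhOp μ w q)^[N + 1] g) t * v t * w t ∂μ := by
      have iA : Integrable (fun t => (∑ k ∈ Finset.range (N + 1), ((imhOp μ w q)^[k] g) t)
          * v t * w t) μ := integrable_mul_mul_weight hw0 hwm hwi hm hvm hb hvb
      have iB : Integrable (fun t => imhOp μ w q
          (fun y => ∑ k ∈ Finset.range (N + 1), ((imhOp μ w q)^[k] g) y) t * v t * w t) μ :=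
        integrable_mul_mul_weight hw0 hwm hwi (measurable_imhOp hwm hqm hm) hvm
          (imhOp_abs_le hw0 hq0 hqi hq1 hb) hvb
      rw [← integral_sub iA iB, ← integral_sub i0 iN1]
      refine integral_congr_ae (Eventually.of_forall fun t => ?_)
      show (∑ k ∈ Finset.range (N + 1), ((imhOp μ w q)^[k] g) t) * v t * w t
          - imhOp μ w q (fun y => ∑ k ∈ Finset.range (N + 1), ((imhOp μ w q)^[k] g) y) t * v t * w t
        = g t * v t * w t - ((imhOp μ w q)^[N + 1] g) t * v t * w t
      rw [hK t, Finset.sum_range_succ' (fun k => ((imhOp μ w q)^[k] g) t),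
        Finset.sum_range_succ (fun k => ((imhOp μ w q)^[k + 1] g) t)]
      simp only [Function.iterate_zero, id_eq]
      ring
    -- Cauchy–Schwarz on the error term
    have hcs : (∫ t, ((imhOp μ w q)^[N + 1] g) t * v t * w t ∂μ) ^ 2 ≤ C (2 * N + 1 + 1) * V := by
      have h := sq_integral_mul_mul_le hw0 hwm hwi hNm hvm hNb hvb
      have e : ∫ t, ((imhOp μ w q)^[N + 1] g) t ^ 2 * w t ∂μ = C (2 * N + 1 + 1) := by
        rw [hCdef]
        simp only
        rw [show 2 * N + 1 + 1 = (N + 1) + (N + 1) by ring, ← two (N + 1) (N + 1)]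
        exact integral_congr_ae (Eventually.of_forall fun t => by ring)
      rw [e] at h
      exact h
    have herr : ∫ t, ((imhOp μ w q)^[N + 1] g) t * v t * w t ∂μ
        ≤ Real.sqrt (C (2 * N + 1 + 1) * V) :=
      (le_abs_self _).trans (Real.abs_le_sqrt hcs)
    linarith
  -- Step 2: the error term tends to zero
  have hlim : Tendsto (fun N : ℕ => S + 2 * Real.sqrt (C (2 * N + 1 + 1) * V)) atTop (𝓝 S) := by
    have h0 : Tendsto (fun k => C (k + 1)) atTop (𝓝 0) := hs.tendsto_atTop_zero
    have h1 : Tendsto (fun N : ℕ => 2 * N + 1) atTop atTop :=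
      StrictMono.tendsto_atTop (fun a b hab => by omega)
    have h2 : Tendsto (fun N : ℕ => C (2 * N + 1 + 1)) atTop (𝓝 0) := h0.comp h1
    have h3 := ((h2.mul_const V).sqrt.const_mul 2).const_add S
    simpa using h3
  exact ge_of_tendsto' hlim hstep

end Summit.Ventures.LatticeQCDFlow.Exactness
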